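import Literature.NumberTheory.EllipticCurves.QuadraticTwistKroneckerEvenLFunctionProofs
import Literature.NumberTheory.EllipticCurves.ComplexMultiplicationShaKnappProofs
import Literature.NumberTheory.EllipticCurves.ComplexMultiplicationLFunctionIsogenyHoldsProofs
import Literature.NumberTheory.EllipticCurves.IsogenyQuadraticTwistProofs
import Literature.NumberTheory.QuadraticFields.FundamentalDiscriminant
import HarnessLib

/-!
# `L(W, s)` is entire on a whole `j`-class, from the periodic twists of ONE curve with a single odd bad prime

Topic `Literature/NumberTheory/EllipticCurves`, namespace `Literature.NumberTheory.EllipticCurves`.  THEOREMS ONLY, no definition.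
The bookkeeping step «one curve ⇒ its `j`-class» of the Deuring–Hecke leaf `hasEntireLFunction_of_j_mem_maximalCMJInvariants`
(Silverman, *Advanced Topics* II Cor. 10.5.1), written once for all of Gross's curves `A(q)` (`q = 11, 19, 43, 67, 163`; `X121…`, `X361…`)
instead of per-row twist-family models (`X049TwistFamily`, `cm28Codomain`).  Let `E/ℚ` be an elliptic curve with `j(E) ≠ 0, 1728` and:

* (T) every periodic twist `Σ_n c(n) a_n(E) n^{−s}` (`c : ℤ/m₀ → ℂ`) is the restriction to `Re s > 3/2` of an entire function
  (for `A(q)`: Hecke's theta series, `OmegaPrime.exists_differentiable_twist`);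
* (G) `E` has good reduction at every prime `≠ q`, `q` an odd prime;
* (I) `E` is `ℚ`-isogenous to its quadratic twist `E^{(−q)}` (CM by `ℚ(√−q)`: `isIsogenous_quadraticTwist_cmFieldDiscr_holds`).

Then:
* `hasEntireLFunction_quadraticTwist_of_not_dvd` — `L(E^{(d)}, s)` is entire for every square-free `d` with `q ∤ d`: by the tree's
  Kronecker-twist formulas `a_n(E^{(d)}) = (n/|d|) a_n(E)` (`d ≡ 1 (mod 4)`, `LFunction_quadraticTwist_apply_of_emod_four_eq_one`) resp.
  `a_n(E^{(4d)}) = 𝟙[n odd](d/n) a_n(E)` (`d ≡ 2, 3 (mod 4)`, `LFunction_quadraticTwist_apply_of_four_dvd_discr`, `E^{(4d)} ≅ E^{(d)}`) the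
  `L`-series of the twist is a periodic twist of `L(E, s)`, entire by (T);
* `hasEntireLFunction_quadraticTwist` — the same for EVERY square-free `d ≠ 0`: if `q ∣ d`, `d = (−q)(−d₁)` and
  `E^{(d)} = (E^{(−q)})^{(−d₁)} ∼ E^{(−d₁)}` (isogenies twist, `IsIsogenous.quadraticTwist`; `ℚ`-isogenous curves have equal `L`-functions,
  `LFunction_eq_of_isIsogenous_holds`, Knapp 11.67), reducing to `q ∤ d₁`;
* ★ `hasEntireLFunction_of_j_eq_of_twists` — **`W.HasEntireLFunction` for EVERY elliptic curve `W/ℚ` with `j(W) = j(E)`** (`C • W = E^{(d)}`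
  with `d` square-free, Silverman X.5.4.1 `exists_variableChange_eq_quadraticTwist_intCast_of_j_eq`; `hasEntireLFunction_smul_iff`).

Nothing about BSD is proved here; no modularity is used.

## References
* J. H. Silverman, *Advanced Topics in the Arithmetic of Elliptic Curves* (1994), II Cor. 10.5.1. [SilvermanATAEC1994]
* J. H. Silverman, *The Arithmetic of Elliptic Curves*, 2nd ed. (2009), X.2 with Exercise 10.16, X.5 Cor. 5.4.1. [SilvermanAEC2009]
* A. W. Knapp, *Elliptic Curves* (1992), Thm. 11.67. [Knapp1993]
* D. A. Cox, *Primes of the form x² + ny²*, 2nd ed. (2013), §1.C (1.17)–(1.18) (Kronecker's character). [Cox2013]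

## Mathlib / tree search
Tree: `WeierstrassCurve.{HasEntireLFunction, entireContinuations, LFunction_quadraticTwist_apply_of_emod_four_eq_one,
LFunction_quadraticTwist_apply_of_four_dvd_discr, hasEntireLFunction_smul_iff, isElliptic_quadraticTwist, quadraticTwist_quadraticTwist,
exists_variableChange_quadraticTwist_mul_sq, IsIsogenous.quadraticTwist}`, `exists_variableChange_eq_quadraticTwist_intCast_of_j_eq`,
`LFunction_eq_of_isIsogenous_holds`, `LSeries_eq_of_LFunction_eq`, `Quadratic.exists_numberField_discr_eq`, `X049.hasEntireLFunction_cm28Codomain`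
(the per-model precedent).  Mathlib: `LSeries_congr`, `jacobiSym.{mod_left, mod_right}`, `ZMod.val_natCast`, `Squarefree.squarefree_of_dvd`.
-/

noncomputable section

open scoped Classical NumberTheorySymbols

namespace Literature.NumberTheory.EllipticCurves

open _root_.WeierstrassCurve IsDedekindDomain NumberField Rat.HeightOneSpectrum Literature.NumberTheory.QuadraticFields

variable (E : WeierstrassCurve ℚ) [E.IsElliptic]

/-! ### §1 Two transport lemmas -/

/-- Curves with equal formal `L`-functions have the same entire-continuation predicate (the continuation depends on `W` only through
`L(W, s) = Σ a_n n^{−s}`). [cite: SilvermanAEC2009, App. C §16] -/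
theorem hasEntireLFunction_of_LFunction_eq {W W' : WeierstrassCurve ℚ} (h : W.LFunction = W'.LFunction)
    (hW' : W'.HasEntireLFunction) : W.HasEntireLFunction := by
  obtain ⟨g, hg, hgs⟩ := hW'
  exact ⟨g, hg, fun s hs ↦ by rw [hgs s hs, LSeries_eq_of_LFunction_eq h]⟩

omit [E.IsElliptic] in
/-- **A curve whose `L`-series is a periodic twist of `L(E, s)` inherits (T)**: if `a_n(W) = c(n) a_n(E)` for a function `c` on `ℤ/m₀` and
every periodic twist of `L(E, s)` has an entire continuation, then `L(W, s)` is entire. [cite: SilvermanATAEC1994, II Cor. 10.5.1] -/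
theorem hasEntireLFunction_of_apply_eq_twist
    (htw : ∀ (m₀ : ℕ) [NeZero m₀] (c : ZMod m₀ → ℂ), ∃ L : ℂ → ℂ, Differentiable ℂ L ∧
      ∀ s : ℂ, 3 / 2 < s.re → L s = LSeries (fun n : ℕ ↦ c (n : ZMod m₀) * (E.LFunction n : ℂ)) s)
    {W : WeierstrassCurve ℚ} {m₀ : ℕ} [NeZero m₀] (c : ZMod m₀ → ℂ)
    (hW : ∀ n : ℕ, ((W.LFunction n : ℤ) : ℂ) = c (n : ZMod m₀) * (E.LFunction n : ℂ)) : W.HasEntireLFunction := by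
  obtain ⟨L, hL, hLs⟩ := htw m₀ c
  refine ⟨L, hL, fun s hs ↦ ?_⟩
  rw [hLs s hs, WeierstrassCurve.LSeries]
  exact LSeries_congr (fun {n} _ ↦ by rw [Function.comp_apply, hW n]) s

/-! ### §2 Square-free twists prime to `q` -/

/-- A square-free integer is `≢ 0 (mod 4)`. [folklore] -/
private theorem emod_four_ne_zero_of_squarefree {d : ℤ} (hsq : Squarefree d) : d % 4 ≠ 0 := by
  intro h4
  have hu := hsq 2 ⟨d / 4, by omega⟩
  rw [Int.isUnit_iff] at hu
  omega

/-- A prime dividing `4d` is `2` or divides `d`. [folklore] -/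
private theorem eq_two_or_dvd_of_dvd_four_mul {d : ℤ} {p : ℕ} (hp : p.Prime) (h : (p : ℤ) ∣ 4 * d) : p = 2 ∨ (p : ℤ) ∣ d := by
  rcases (Nat.prime_iff_prime_int.mp hp).dvd_or_dvd h with h4 | hd
  · left
    have h22 : (p : ℤ) ∣ 2 * 2 := by simpa using h4
    have h2 : (p : ℤ) ∣ 2 := by
      rcases (Nat.prime_iff_prime_int.mp hp).dvd_or_dvd h22 with h | h <;> exact h
    have : p ∣ 2 := by exact_mod_cast h2
    exact (Nat.prime_dvd_prime_iff_eq hp Nat.prime_two).mp this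
  · exact Or.inr hd

/-- **`L(E^{(d)}, s)` is entire for square-free `d ≡ 1 (mod 4)` prime to the bad prime `q`**: `a_n(E^{(d)}) = (n/|d|) a_n(E)` for all `n`
(Kronecker's `χ_d`, period `|d|`). [cite: SilvermanAEC2009, X.2 and Exercise 10.16] [cite: Cox2013, §1.C (1.17)–(1.18)] -/
theorem hasEntireLFunction_quadraticTwist_of_emod_four_eq_one {q : ℕ}
    (htw : ∀ (m₀ : ℕ) [NeZero m₀] (c : ZMod m₀ → ℂ), ∃ L : ℂ → ℂ, Differentiable ℂ L ∧
      ∀ s : ℂ, 3 / 2 < s.re → L s = LSeries (fun n : ℕ ↦ c (n : ZMod m₀) * (E.LFunction n : ℂ)) s)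
    (hgood : ∀ v : HeightOneSpectrum (𝓞 ℚ), (primesEquiv v : ℕ) ≠ q → E.HasGoodReductionAt v)
    {d : ℤ} (hsq : Squarefree d) (hd4 : d % 4 = 1) (hqd : ¬ (q : ℤ) ∣ d) :
    (E.quadraticTwist (d : ℚ)).HasEntireLFunction := by
  have hd : d ≠ 0 := by rintro rfl; norm_num at hd4
  haveI : NeZero d.natAbs := ⟨Int.natAbs_ne_zero.mpr hd⟩
  have hgood' : ∀ v : HeightOneSpectrum (𝓞 ℚ), ((primesEquiv v : ℕ) : ℤ) ∣ d → E.HasGoodReductionAt v :=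
    fun v hv ↦ hgood v fun heq ↦ hqd (heq ▸ hv)
  refine hasEntireLFunction_of_apply_eq_twist E htw (fun r : ZMod d.natAbs ↦ (J((r.val : ℤ) | d.natAbs) : ℂ)) fun n ↦ ?_
  rw [E.LFunction_quadraticTwist_apply_of_emod_four_eq_one hd4 hsq hgood' n, ZMod.val_natCast, Int.natCast_mod,
    ← jacobiSym.mod_left]
  push_cast
  ring

/-- **`L(E^{(d)}, s)` is entire for square-free `d ≡ 2, 3 (mod 4)` prime to the ODD bad prime `q`**: `E^{(d)} ≅ E^{(4d)}` and
`a_n(E^{(4d)}) = 𝟙[n odd](d/n) a_n(E)` (the even fundamental discriminant `4d`, period `4|d|`; good reduction of `E` at `2` and at the primes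
of `d`). [cite: SilvermanAEC2009, X.2 and Exercise 10.16] [cite: Cox2013, §1.C Lemma 1.14] -/
theorem hasEntireLFunction_quadraticTwist_of_emod_four_ne_one {q : ℕ} (hq2 : q ≠ 2)
    (htw : ∀ (m₀ : ℕ) [NeZero m₀] (c : ZMod m₀ → ℂ), ∃ L : ℂ → ℂ, Differentiable ℂ L ∧
      ∀ s : ℂ, 3 / 2 < s.re → L s = LSeries (fun n : ℕ ↦ c (n : ZMod m₀) * (E.LFunction n : ℂ)) s)
    (hgood : ∀ v : HeightOneSpectrum (𝓞 ℚ), (primesEquiv v : ℕ) ≠ q → E.HasGoodReductionAt v)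
    {d : ℤ} (hsq : Squarefree d) (hd4 : d % 4 ≠ 1) (hqd : ¬ (q : ℤ) ∣ d) :
    (E.quadraticTwist (d : ℚ)).HasEntireLFunction := by
  have hd : d ≠ 0 := hsq.ne_zero
  have hd0 := emod_four_ne_zero_of_squarefree hsq
  haveI : NeZero (4 * d.natAbs) := ⟨Nat.mul_ne_zero (by norm_num) (Int.natAbs_ne_zero.mpr hd)⟩
  -- the quadratic field of discriminant `4d`
  obtain ⟨K, _, _, h2, hdisc⟩ := Quadratic.exists_numberField_discr_eq (D := 4 * d)
    (Or.inr ⟨dvd_mul_right 4 d, by omega, by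
      rw [show (4 * d) / 4 = d by omega]; exact hsq⟩)
  have hgood' : ∀ v : HeightOneSpectrum (𝓞 ℚ), ((primesEquiv v : ℕ) : ℤ) ∣ NumberField.discr K → E.HasGoodReductionAt v := by
    intro v hv
    rw [hdisc] at hv
    refine hgood v fun heq ↦ ?_
    rcases eq_two_or_dvd_of_dvd_four_mul (primesEquiv v).2 hv with h | h
    · exact hq2 (heq ▸ h)
    · exact hqd (heq ▸ h)
  -- `E^{(4d)}` is entire: its coefficients are the twist of `a_n(E)` by `𝟙[n odd](d/n)`, period `4|d|`
  have h4d : (E.quadraticTwist ((4 * d : ℤ) : ℚ)).HasEntireLFunction := by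
    have h4 : 2 ∣ 4 * d.natAbs := ⟨2 * d.natAbs, by ring⟩
    refine hasEntireLFunction_of_apply_eq_twist E htw
      (fun r : ZMod (4 * d.natAbs) ↦ if Odd r.val then (J(d | r.val) : ℂ) else 0) fun n ↦ ?_
    have key := E.LFunction_quadraticTwist_apply_of_four_dvd_discr K h2 (hdisc ▸ dvd_mul_right 4 d) hgood' n
    rw [hdisc, show (4 * d) / 4 = d by omega] at key
    rw [key, ZMod.val_natCast]
    by_cases hn : Odd n
    · have hmod : Odd (n % (4 * d.natAbs)) := by
        rw [Nat.odd_iff, Nat.mod_mod_of_dvd n h4]; exact Nat.odd_iff.mp hn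
      rw [if_neg (Nat.not_even_iff_odd.mpr hn), if_pos hmod, ← jacobiSym.mod_right d hn]
      push_cast
      ring
    · have hmod : ¬ Odd (n % (4 * d.natAbs)) := by
        rw [Nat.odd_iff, Nat.mod_mod_of_dvd n h4]; exact fun h ↦ hn (Nat.odd_iff.mpr h)
      rw [if_pos (Nat.not_odd_iff_even.mp hn), if_neg hmod]
      push_cast
      ring
  -- `E^{(d)} ≅ E^{(4d)}`
  obtain ⟨C, hC⟩ := E.exists_variableChange_quadraticTwist_mul_sq (d : ℚ) 2 two_ne_zero
  have h4d' : ((4 * d : ℤ) : ℚ) = (d : ℚ) * 2 ^ 2 := by push_cast; ring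
  rw [h4d', ← hC] at h4d
  haveI : (E.quadraticTwist (d : ℚ)).IsElliptic := E.isElliptic_quadraticTwist (Int.cast_ne_zero.mpr hd)
  exact (hasEntireLFunction_smul_iff _ C).mp h4d

/-- **`L(E^{(d)}, s)` is entire for every square-free `d` prime to the odd bad prime `q`.** [cite: SilvermanAEC2009, X.2 and Exercise 10.16] -/
theorem hasEntireLFunction_quadraticTwist_of_not_dvd {q : ℕ} (hq2 : q ≠ 2)
    (htw : ∀ (m₀ : ℕ) [NeZero m₀] (c : ZMod m₀ → ℂ), ∃ L : ℂ → ℂ, Differentiable ℂ L ∧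
      ∀ s : ℂ, 3 / 2 < s.re → L s = LSeries (fun n : ℕ ↦ c (n : ZMod m₀) * (E.LFunction n : ℂ)) s)
    (hgood : ∀ v : HeightOneSpectrum (𝓞 ℚ), (primesEquiv v : ℕ) ≠ q → E.HasGoodReductionAt v)
    {d : ℤ} (hsq : Squarefree d) (hqd : ¬ (q : ℤ) ∣ d) :
    (E.quadraticTwist (d : ℚ)).HasEntireLFunction := by
  by_cases hd4 : d % 4 = 1
  · exact hasEntireLFunction_quadraticTwist_of_emod_four_eq_one E htw hgood hsq hd4 hqd
  · exact hasEntireLFunction_quadraticTwist_of_emod_four_ne_one E hq2 htw hgood hsq hd4 hqd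

/-! ### §3 All square-free twists, and the whole `j`-class -/

/-- ★ **`L(E^{(d)}, s)` is entire for EVERY square-free `d ≠ 0`**, given (T), (G) and the CM isogeny `E ∼ E^{(−q)}`: if `q ∣ d` then
`d = (−q)(−d₁)` with `q ∤ d₁` and `E^{(d)} = (E^{(−q)})^{(−d₁)}` is `ℚ`-isogenous to `E^{(−d₁)}`, so has the same `L`-function (Knapp 11.67).
[cite: Knapp1993, Thm. 11.67] [cite: SilvermanATAEC1994, II Cor. 10.5.1] -/
theorem hasEntireLFunction_quadraticTwist {q : ℕ} (hq : q.Prime) (hq2 : q ≠ 2)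
    (htw : ∀ (m₀ : ℕ) [NeZero m₀] (c : ZMod m₀ → ℂ), ∃ L : ℂ → ℂ, Differentiable ℂ L ∧
      ∀ s : ℂ, 3 / 2 < s.re → L s = LSeries (fun n : ℕ ↦ c (n : ZMod m₀) * (E.LFunction n : ℂ)) s)
    (hgood : ∀ v : HeightOneSpectrum (𝓞 ℚ), (primesEquiv v : ℕ) ≠ q → E.HasGoodReductionAt v)
    (hiso : IsIsogenous E (E.quadraticTwist (-(q : ℚ))))
    {d : ℤ} (hd : d ≠ 0) (hsq : Squarefree d) : (E.quadraticTwist (d : ℚ)).HasEntireLFunction := by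
  by_cases hqd : (q : ℤ) ∣ d
  · obtain ⟨d₁, hd₁⟩ := hqd
    have hd₁0 : d₁ ≠ 0 := by rintro rfl; exact hd (by rw [hd₁, mul_zero])
    have hsq₁ : Squarefree (-d₁) := hsq.squarefree_of_dvd ⟨-q, by rw [hd₁]; ring⟩
    have hqd₁ : ¬ (q : ℤ) ∣ -d₁ := by
      rintro ⟨t, ht⟩
      have hu := hsq q ⟨-t, by rw [hd₁, show d₁ = -(q * t) by linarith]; ring⟩
      rw [Int.isUnit_iff] at hu
      have := hq.two_le
      omega
    -- `E^{(−d₁)}` is entire by §2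
    have hA := hasEntireLFunction_quadraticTwist_of_not_dvd E hq2 htw hgood hsq₁ hqd₁
    -- `E^{(−d₁)} ∼ (E^{(−q)})^{(−d₁)} = E^{(d)}`
    have hne : ((-d₁ : ℤ) : ℚ) ≠ 0 := by exact_mod_cast neg_ne_zero.mpr hd₁0
    have hiso' := hiso.quadraticTwist (d := ((-d₁ : ℤ) : ℚ)) hne
    rw [quadraticTwist_quadraticTwist, show (-(q : ℚ)) * ((-d₁ : ℤ) : ℚ) = ((d : ℤ) : ℚ) by rw [hd₁]; push_cast; ring] at hiso'
    haveI : (E.quadraticTwist ((-d₁ : ℤ) : ℚ)).IsElliptic := E.isElliptic_quadraticTwist hne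
    haveI : (E.quadraticTwist (d : ℚ)).IsElliptic := E.isElliptic_quadraticTwist (Int.cast_ne_zero.mpr hd)
    exact hasEntireLFunction_of_LFunction_eq (LFunction_eq_of_isIsogenous_holds _ _ hiso').symm hA
  · exact hasEntireLFunction_quadraticTwist_of_not_dvd E hq2 htw hgood hsq hqd

/-- ★★ **`L(W, s)` is entire for EVERY elliptic curve `W/ℚ` with `j(W) = j(E)`** (`j(E) ≠ 0, 1728`), given: (T) every periodic twist of
`L(E, s)` has an entire continuation, (G) `E` has good reduction away from one odd prime `q`, (I) `E ∼ E^{(−q)}` over `ℚ`.  Every such `W` is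
`ℚ`-isomorphic to a square-free twist `E^{(d)}` (Silverman X.5 Cor. 5.4.1) and `HasEntireLFunction` is an isomorphism invariant.  This is the
«one curve ⇒ whole class» step of the Deuring–Hecke leaf `hasEntireLFunction_of_j_mem_maximalCMJInvariants` for Gross's `A(q)`.
[cite: SilvermanATAEC1994, II Cor. 10.5.1] [cite: SilvermanAEC2009, X.5 Cor. 5.4.1] [cite: Knapp1993, Thm. 11.67] -/
theorem hasEntireLFunction_of_j_eq_of_twists {q : ℕ} (hq : q.Prime) (hq2 : q ≠ 2)
    (htw : ∀ (m₀ : ℕ) [NeZero m₀] (c : ZMod m₀ → ℂ), ∃ L : ℂ → ℂ, Differentiable ℂ L ∧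
      ∀ s : ℂ, 3 / 2 < s.re → L s = LSeries (fun n : ℕ ↦ c (n : ZMod m₀) * (E.LFunction n : ℂ)) s)
    (hgood : ∀ v : HeightOneSpectrum (𝓞 ℚ), (primesEquiv v : ℕ) ≠ q → E.HasGoodReductionAt v)
    (hiso : IsIsogenous E (E.quadraticTwist (-(q : ℚ)))) (h0 : E.j ≠ 0) (h1728 : E.j ≠ 1728)
    (W : WeierstrassCurve ℚ) [W.IsElliptic] (hj : W.j = E.j) : W.HasEntireLFunction := by
  obtain ⟨d, hd, hsq, C, hC⟩ := exists_variableChange_eq_quadraticTwist_intCast_of_j_eq (W := W) (E := E) hj h0 h1728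
  have h := hasEntireLFunction_quadraticTwist E hq hq2 htw hgood hiso hd hsq
  rw [← hC] at h
  exact (hasEntireLFunction_smul_iff W C).mp h

end Literature.NumberTheory.EllipticCurves

end
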